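import Summits.AtomisticToContinuum.HydrodynamicLimit.Theorems.JaynesSqueezeSqueezeToBlockGibbsReference
import Summits.AtomisticToContinuum.HydrodynamicLimit.Theorems.JaynesSqueezeSqueezeToBlockGibbsIntensity
import Summits.AtomisticToContinuum.HydrodynamicLimit.Theorems.JaynesSqueezeSqueezeToBlockGibbsTimeZero

/-!
# The squeeze `SqueezeToBlockGibbs` (route JaynesSqueeze), VI: the block side of the bookkeeping

Helper file (`--supports stmt-AtomisticToContinuum-13463`) for the support item `SqueezeToBlockGibbs` of route
`JaynesSqueeze`. For the evolved local Gibbs law `λ_N` at time `s` and a BLOCK-CONSTANT local Gibbs reference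
`Ψ = localGibbsLaw σ (ca ∘ idx) (cu ∘ idx) (cθ ∘ idx) N Φ` (blocks of side `1/m`), the transport identity of part I
is made explicit in the block data of the one-body intensity measure `μ_s` of `lawAt Φ λ_N s`:

* `toReal_klDiv_lawAt_blockRef` —
  `KL(lawAt Φ λ_N s ‖ Ψ) = (N+1)(E_λ⟨emp, log prof₀⟩ − Σ_k [m_k (log ca_k + log (2π cθ_k)^{-3/2}) − (2cθ_k)⁻¹ ∫|v − cu_k|² dμ_{s,k}])
   + log Z − log Z₀`, with `m_k`, `μ_{s,k}` the block masses and block velocity measures, and `KL < ∞`;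
* `sum_blockMass_eq_one` — `Σ_k m_k = 1`;
* `blockGibbs_core` — THE SQUEEZE AT ONE `(N, s)` (Csiszár's I-projection up to the static approximation): with the
  block-matched choice `ca_k = r_k e^{g(r_k)}`, `r_k = m³ m_k`, `cu_k =` block mean velocity, `cθ_k =` block kinetic
  temperature, the three analytic inputs (entropy bound of `NoMeanEntropyProduction` with slack `δ₁`, time-zero
  limit with slack `δ₂`, local density approximation with slack `δ₃`) give `KL(lawAt Φ λ_N s ‖ Ψ) ≤ (δ₁+δ₂+δ₃)(N+1)`
  together with the parameter bounds of `BlockGibbs`. Pure bookkeeping: every analytic input is a hypothesis here.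

References: Yau 1991 §2; Csiszár 1975 (I-projection); Jaynes 1965.
-/

noncomputable section

open MeasureTheory Filter Set Topology InformationTheory
open scoped ENNReal

namespace Summit.AtomisticToContinuum.HydrodynamicLimit.Theorems.JaynesSqueezeSqueeze

open Literature.MathematicalPhysics.KineticTheory Literature.Analysis.FluidPDE
open Literature.Analysis.FunctionSpaces
open MacroClosureLine.StubLedger

/-! ## Integrability of quadratic one-body observables against the law at time `s` -/

/-- A one-body observable of quadratic growth in the velocity is integrable, particle by particle, under a finite
law with integrable kinetic energy pairing. [folklore] -/
theorem integrable_apply_of_quadratic {N : ℕ} (Q : Measure (Config (N + 1) (Fin 3) T3)) [IsFiniteMeasure Q]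
    (hK : Integrable (fun z => ∫ y, ‖y.2‖ ^ 2 ∂(empiricalMeasure z)) Q) {h : T3 × V3 → ℝ} (hm : Measurable h)
    {C : ℝ} (hC : ∀ x v, |h (x, v)| ≤ C * (1 + ‖v‖ ^ 2)) (i : Fin (N + 1)) :
    Integrable (fun z : Config (N + 1) (Fin 3) T3 => h (z i)) Q := by
  refine (((integrable_const C).add ((integrable_norm_sq_apply Q hK i).const_mul C))).mono'
    (hm.comp (measurable_pi_apply i)).aestronglyMeasurable (ae_of_all _ fun z => ?_)
  rw [Real.norm_eq_abs]
  calc |h (z i)| = |h ((z i).1, (z i).2)| := rfl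
    _ ≤ C * (1 + ‖(z i).2‖ ^ 2) := hC _ _
    _ = C + C * ‖(z i).2‖ ^ 2 := by ring

/-! ## The transport identity in block form -/

/-- **The bookkeeping identity for a block-constant reference, in block form.** For `σ ≤ 1/2`, continuous
positive data profiles, `0 < m`, block parameters `ca, cθ > 0`, `cu` bounded by `(A, Θ, V)` (`A, Θ ≥ 1`):
`KL(lawAt Φ λ_N s ‖ Ψ) = (N+1)(E_λ⟨emp, log prof₀⟩ − Σ_{k ∈ range m ^ 3} [m_k (log ca_k + log (2π cθ_k)^{-3/2})
 − (2cθ_k)⁻¹ ∫ |v − cu_k|² dμ_{s,k}]) + log Z − log Z₀` and `KL < ∞`, where `μ_{s,k}` is the block velocity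
measure of the intensity measure of `lawAt Φ λ_N s` and `m_k` its mass. [folklore] -/
theorem toReal_klDiv_lawAt_blockRef {σ : ℝ} (hσ2 : σ ≤ 1 / 2) (N : ℕ)
    (Φ : HardSphereFlow (Torus.geometry (Fin 3)) (hsDiameter σ N) (N + 1))
    {a₀ θ₀ : T3 → ℝ} {u₀ : T3 → V3} (ha : Continuous a₀) (hθ : Continuous θ₀) (hu : Continuous u₀)
    (ha0 : ∀ x, 0 < a₀ x) (hθ0 : ∀ x, 0 < θ₀ x) {m : ℕ} (hm : 0 < m) (s : ℝ)
    {ca cθ : (Fin 3 → ℕ) → ℝ} {cu : (Fin 3 → ℕ) → V3} {A Θ V : ℝ} (hA : 1 ≤ A) (hΘ : 1 ≤ Θ)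
    (hb : ∀ k, A⁻¹ ≤ ca k ∧ ca k ≤ A ∧ Θ⁻¹ ≤ cθ k ∧ cθ k ≤ Θ ∧ ‖cu k‖ ≤ V) :
    (klDiv (Φ.lawAt (localGibbsLaw σ a₀ u₀ θ₀ N Φ) s)
        (localGibbsLaw σ (fun x => ca (fun i => ⌊(m : ℝ) * Torus.repr x i⌋₊))
          (fun x => cu (fun i => ⌊(m : ℝ) * Torus.repr x i⌋₊))
          (fun x => cθ (fun i => ⌊(m : ℝ) * Torus.repr x i⌋₊)) N Φ)).toReal =
        ((N : ℝ) + 1) *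
            ((∫ z, (∫ y, Real.log (localGibbsProfile a₀ u₀ θ₀ y) ∂(empiricalMeasure z))
                ∂(localGibbsLaw σ a₀ u₀ θ₀ N Φ)) -
              ∑ k ∈ Fintype.piFinset (fun _ : Fin 3 => Finset.range m),
                (((((((N : ℝ≥0∞) + 1)⁻¹ • Measure.sum fun i : Fin (N + 1) =>
                    (Φ.lawAt (localGibbsLaw σ a₀ u₀ θ₀ N Φ) s).map fun z => z i).restrict
                    ({x : T3 | (fun i => ⌊(m : ℝ) * Torus.repr x i⌋₊) = k} ×ˢ (univ : Set V3))).snd) univ).toReal *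
                    (Real.log (ca k) + Real.log ((2 * Real.pi * cθ k) ^ (-(Module.finrank ℝ V3 : ℝ) / 2))) -
                  (2 * cθ k)⁻¹ * ∫ v, ‖v - cu k‖ ^ 2 ∂(((((N : ℝ≥0∞) + 1)⁻¹ • Measure.sum fun i : Fin (N + 1) =>
                    (Φ.lawAt (localGibbsLaw σ a₀ u₀ θ₀ N Φ) s).map fun z => z i).restrict
                    ({x : T3 | (fun i => ⌊(m : ℝ) * Torus.repr x i⌋₊) = k} ×ˢ (univ : Set V3))).snd))) +
          Real.log (canonicalPartition (Torus.geometry (Fin 3)) (hsDiameter σ N) (N + 1)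
            (localGibbsProfile (fun x => ca (fun i => ⌊(m : ℝ) * Torus.repr x i⌋₊))
              (fun x => cu (fun i => ⌊(m : ℝ) * Torus.repr x i⌋₊))
              (fun x => cθ (fun i => ⌊(m : ℝ) * Torus.repr x i⌋₊)))) -
          Real.log (canonicalPartition (Torus.geometry (Fin 3)) (hsDiameter σ N) (N + 1)
            (localGibbsProfile a₀ u₀ θ₀)) ∧
      klDiv (Φ.lawAt (localGibbsLaw σ a₀ u₀ θ₀ N Φ) s)
        (localGibbsLaw σ (fun x => ca (fun i => ⌊(m : ℝ) * Torus.repr x i⌋₊))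
          (fun x => cu (fun i => ⌊(m : ℝ) * Torus.repr x i⌋₊))
          (fun x => cθ (fun i => ⌊(m : ℝ) * Torus.repr x i⌋₊)) N Φ) ≠ ⊤ := by
  have hApos : 0 < A := by linarith
  have hΘpos : 0 < Θ := by linarith
  have hca0 : ∀ k, 0 < ca k := fun k => (inv_pos.2 hApos).trans_le (hb k).1
  have hcθ0 : ∀ k, 0 < cθ k := fun k => (inv_pos.2 hΘpos).trans_le (hb k).2.2.1
  -- the reference parameters as measurable bounded functions of the position
  have hidx := measurable_blockIdx m
  have hma : Measurable fun x : T3 => ca (fun i => ⌊(m : ℝ) * Torus.repr x i⌋₊) := (measurable_of_countable ca).comp hidx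
  have hmθ : Measurable fun x : T3 => cθ (fun i => ⌊(m : ℝ) * Torus.repr x i⌋₊) := (measurable_of_countable cθ).comp hidx
  have hmu : Measurable fun x : T3 => cu (fun i => ⌊(m : ℝ) * Torus.repr x i⌋₊) := (measurable_of_countable cu).comp hidx
  have hK0 := integrable_kineticPair_localGibbsLaw hσ2 ha hθ hu ha0 hθ0 N Φ
  have hKt := integrable_kineticPair_flow_localGibbsLaw hσ2 ha hθ hu ha0 hθ0 N Φ s
  obtain ⟨hid, hfin⟩ := toReal_klDiv_lawAt_localGibbsLaw_ref hσ2 N Φ ha hθ hu ha0 hθ0 hma hmθ hmu hA hΘ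
    (fun x => ⟨(hb _).1, (hb _).2.1⟩) (fun x => ⟨(hb _).2.2.1, (hb _).2.2.2.1⟩) (fun x => (hb _).2.2.2.2) s hK0 hKt
  refine ⟨?_, hfin⟩
  -- the cross term: mean of a one-body sum = integral against the intensity measure, then blockwise
  haveI hP : IsProbabilityMeasure (localGibbsLaw σ a₀ u₀ θ₀ N Φ) :=
    isProbabilityMeasure_localGibbsLaw ha hθ hu ha0 hθ0 hσ2 N Φ
  set P := localGibbsLaw σ a₀ u₀ θ₀ N Φ with hPdef
  set Q := Φ.lawAt P s with hQ
  haveI hQ1 : IsProbabilityMeasure Q := by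
    rw [hQ, HardSphereFlow.lawAt_eq]; exact Measure.isProbabilityMeasure_map (Φ.measurable_flow s).aemeasurable
  set h : T3 × V3 → ℝ := fun y => Real.log (localGibbsProfile (fun x => ca (fun i => ⌊(m : ℝ) * Torus.repr x i⌋₊))
    (fun x => cu (fun i => ⌊(m : ℝ) * Torus.repr x i⌋₊)) (fun x => cθ (fun i => ⌊(m : ℝ) * Torus.repr x i⌋₊)) y)
    with hh
  have hhm : Measurable h := Real.measurable_log.comp (stronglyMeasurable_localGibbsProfile hma hmθ hmu).measurable
  obtain ⟨C, -, hC⟩ := exists_abs_log_localGibbsProfile_le_of_bounds V hA hΘ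
  have hCb : ∀ x v, |h (x, v)| ≤ C * (1 + ‖v‖ ^ 2) :=
    hC _ _ _ (fun x => ⟨(hb _).1, (hb _).2.1⟩) (fun x => ⟨(hb _).2.2.1, (hb _).2.2.2.1⟩) (fun x => (hb _).2.2.2.2)
  -- kinetic energy pairing under `Q`
  have hKQ : Integrable (fun z => ∫ y, ‖y.2‖ ^ 2 ∂(empiricalMeasure z)) Q := by
    rw [hQ, HardSphereFlow.lawAt_eq]
    have hm1 : Measurable fun z : Config (N + 1) (Fin 3) T3 => ∫ y, ‖y.2‖ ^ 2 ∂(empiricalMeasure z) := by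
      simp_rw [kineticPair_eq_sum]
      exact measurable_const.mul (Finset.measurable_sum _ fun i _ => (measurable_pi_apply i).snd.norm.pow_const 2)
    exact (integrable_map_measure hm1.aestronglyMeasurable (Φ.measurable_flow s).aemeasurable).2 hKt
  -- step 1: `E_P ⟨emp ∘ Φ_s, h⟩ = E_Q ⟨emp, h⟩`
  have h1 : ∫ z, (∫ y, h y ∂(empiricalMeasure (Φ.flow s z))) ∂P = ∫ z, (∫ y, h y ∂(empiricalMeasure z)) ∂Q := by
    rw [hQ, HardSphereFlow.lawAt_eq, integral_map (Φ.measurable_flow s).aemeasurable]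
    exact (measurable_logPair_comp measurable_id hma hmθ hmu).aestronglyMeasurable
  -- step 2: `E_Q ⟨emp, h⟩ = ∫ h dμ_Q`
  have h2 : ∫ z, (∫ y, h y ∂(empiricalMeasure z)) ∂Q =
      ∫ y, h y ∂(((N : ℝ≥0∞) + 1)⁻¹ • Measure.sum fun i : Fin (N + 1) => Q.map fun z => z i) :=
    (integral_intensity_eq Q hhm.stronglyMeasurable (integrable_apply_of_quadratic Q hKQ hhm hCb)).symm
  -- step 3: blockwise
  set μ : Measure (T3 × V3) := ((N : ℝ≥0∞) + 1)⁻¹ • Measure.sum fun i : Fin (N + 1) => Q.map fun z => z i with hμ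
  haveI hμ1 : IsProbabilityMeasure μ := isProbabilityMeasure_intensity Q
  have hμ2 : Integrable (fun y : T3 × V3 => ‖y.2‖ ^ 2) μ := (integral_norm_sq_intensity Q hKQ).1
  set H : (Fin 3 → ℕ) → V3 → ℝ := fun k v =>
    Real.log (ca k) + Real.log ((2 * Real.pi * cθ k) ^ (-(Module.finrank ℝ V3 : ℝ) / 2)) - ‖v - cu k‖ ^ 2 / (2 * cθ k)
    with hH
  have hhH : ∀ y : T3 × V3, h y = H (fun i => ⌊(m : ℝ) * Torus.repr y.1 i⌋₊) y.2 := by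
    rintro ⟨x, v⟩
    exact log_localGibbsProfile_block m cu hca0 hcθ0 x v
  have hHm : ∀ k, StronglyMeasurable (H k) := fun k => by
    refine Measurable.stronglyMeasurable ?_
    exact measurable_const.sub (((measurable_id.sub_const _).norm.pow_const 2).div_const _)
  have hhi : Integrable h μ := integrable_intensity_of_forall Q hhm.stronglyMeasurable
    (integrable_apply_of_quadratic Q hKQ hhm hCb)
  have h3 : ∫ y, h y ∂μ = ∑ k ∈ Fintype.piFinset (fun _ : Fin 3 => Finset.range m),
      ∫ v, H k v ∂((μ.restrict ({x : T3 | (fun i => ⌊(m : ℝ) * Torus.repr x i⌋₊) = k} ×ˢ (univ : Set V3))).snd) := by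
    have hhi' : Integrable (fun y : T3 × V3 => H (fun i => ⌊(m : ℝ) * Torus.repr y.1 i⌋₊) y.2) μ :=
      hhi.congr (Eventually.of_forall hhH)
    rw [integral_congr_ae (Eventually.of_forall hhH)]
    exact integral_blockwise_eq_sum μ hm hHm hhi'
  -- step 4: each block
  have h4 : ∀ k, ∫ v, H k v ∂((μ.restrict ({x : T3 | (fun i => ⌊(m : ℝ) * Torus.repr x i⌋₊) = k} ×ˢ
      (univ : Set V3))).snd) =
      (((μ.restrict ({x : T3 | (fun i => ⌊(m : ℝ) * Torus.repr x i⌋₊) = k} ×ˢ (univ : Set V3))).snd) univ).toReal *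
          (Real.log (ca k) + Real.log ((2 * Real.pi * cθ k) ^ (-(Module.finrank ℝ V3 : ℝ) / 2))) -
        (2 * cθ k)⁻¹ * ∫ v, ‖v - cu k‖ ^ 2 ∂((μ.restrict ({x : T3 | (fun i => ⌊(m : ℝ) * Torus.repr x i⌋₊) = k} ×ˢ
          (univ : Set V3))).snd) := by
    intro k
    haveI : IsFiniteMeasure ((μ.restrict ({x : T3 | (fun i => ⌊(m : ℝ) * Torus.repr x i⌋₊) = k} ×ˢ
        (univ : Set V3))).snd) := by infer_instance
    exact integral_blockLogProfile _ (cu k) (integrable_norm_sub_sq_blockVel μ hμ2 m k (cu k))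
  have hcross : ∫ z, (∫ y, h y ∂(empiricalMeasure (Φ.flow s z))) ∂P =
      ∑ k ∈ Fintype.piFinset (fun _ : Fin 3 => Finset.range m),
        ((((μ.restrict ({x : T3 | (fun i => ⌊(m : ℝ) * Torus.repr x i⌋₊) = k} ×ˢ (univ : Set V3))).snd) univ).toReal *
            (Real.log (ca k) + Real.log ((2 * Real.pi * cθ k) ^ (-(Module.finrank ℝ V3 : ℝ) / 2))) -
          (2 * cθ k)⁻¹ * ∫ v, ‖v - cu k‖ ^ 2 ∂((μ.restrict ({x : T3 | (fun i => ⌊(m : ℝ) * Torus.repr x i⌋₊) = k} ×ˢ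
            (univ : Set V3))).snd)) := by
    rw [h1, h2, h3]
    exact Finset.sum_congr rfl fun k _ => h4 k
  rw [hid, hcross]

/-- **The block masses add up to one** (the intensity measure of a probability law is a probability measure
and the blocks of scale `1/m`, `0 < m`, partition the torus). [folklore] -/
theorem sum_blockMass_eq_one {N : ℕ} (Q : Measure (Config (N + 1) (Fin 3) T3)) [IsProbabilityMeasure Q]
    {m : ℕ} (hm : 0 < m) :
    ∑ k ∈ Fintype.piFinset (fun _ : Fin 3 => Finset.range m),
      (((((N : ℝ≥0∞) + 1)⁻¹ • Measure.sum fun i : Fin (N + 1) => Q.map fun z => z i).restrict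
        ({x : T3 | (fun i => ⌊(m : ℝ) * Torus.repr x i⌋₊) = k} ×ˢ (univ : Set V3))).snd univ).toReal = 1 := by
  set μ : Measure (T3 × V3) := ((N : ℝ≥0∞) + 1)⁻¹ • Measure.sum fun i : Fin (N + 1) => Q.map fun z => z i with hμ
  haveI hμ1 : IsProbabilityMeasure μ := isProbabilityMeasure_intensity Q
  have h := integral_blockwise_eq_sum μ hm (H := fun _ _ => (1 : ℝ)) (fun _ => stronglyMeasurable_const)
    (integrable_const 1)
  simp only [integral_const, smul_eq_mul, mul_one, measureReal_def, measure_univ, ENNReal.toReal_one] at h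
  exact h.symm

/-! ## The squeeze at one `(N, s)` -/

/-- **THE SQUEEZE AT ONE `(N, s)`.** Given the block data of the intensity measure of `lawAt Φ λ_N s` on the `m³`
cubes (masses `m_k`, mean velocities `u_k`, kinetic temperatures `θ_k`, given abstractly with their defining equations,
all in the ranges of `MeanBlocksInRange`), the block-matched reference `ca_k = r_k e^{g(r_k)}`, `r_k = m³ m_k`,
`cu_k = u_k`, `cθ_k = θ_k` obeys the parameter bounds of `BlockGibbs`, and the identity `toReal_klDiv_lawAt_blockRef`
becomes `KL/(N+1) = [time-zero term] + [(N+1)⁻¹ log Z_pos − Σ m_k ψ(r_k)] + 𝒮^m_N(s) + 3/2 + (3/2) log 2π`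
(`∫ |v − u_k|² dμ_{s,k} = 3 m_k θ_k`, `Σ m_k = 1`, `g = f_ex(·σ³) + ψ`); so the entropy bound `𝒮^m_N(s) ≤ 𝒮₀ + δ₁`,
the time-zero estimate `|[time-zero term] + 𝒮₀ + 3/2 + (3/2) log 2π| ≤ δ₂` and the local density approximation
`|(N+1)⁻¹ log Z_pos − Σ m⁻³ r_k ψ(r_k)| ≤ δ₃` give `KL ≤ (δ₁ + δ₂ + δ₃)(N+1)`. [folklore] -/
theorem blockGibbs_core {σ : ℝ} (hσ2 : σ ≤ 1 / 2) (N : ℕ)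
    (Φ : HardSphereFlow (Torus.geometry (Fin 3)) (hsDiameter σ N) (N + 1))
    {a₀ θ₀ : T3 → ℝ} {u₀ : T3 → V3} (ha : Continuous a₀) (hθ : Continuous θ₀) (hu : Continuous u₀)
    (ha0 : ∀ x, 0 < a₀ x) (hθ0 : ∀ x, 0 < θ₀ x) {m : ℕ} (hm : 0 < m) (s : ℝ)
    (g ψ : ℝ → ℝ) (hg : ∀ r, g r = hsExcessFreeEnergy (r * σ ^ 3) + ψ r)
    {rlo rhi gB θlo θhi V A Θ : ℝ} (hrlo : 0 < rlo) (hlohi : rlo ≤ rhi) (hgB : ∀ r ∈ Icc rlo rhi, |g r| ≤ gB)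
    (hθlo : 0 < θlo) (hV : 0 ≤ V) (hA1 : 1 ≤ A) (hAlo : A⁻¹ ≤ rlo * Real.exp (-gB))
    (hAhi : rhi * Real.exp gB ≤ A) (hΘ1 : 1 ≤ Θ) (hΘlo : Θ⁻¹ ≤ θlo) (hΘhi : θhi ≤ Θ)
    (mass temp : (Fin 3 → ℕ) → ℝ) (vel : (Fin 3 → ℕ) → V3)
    (hmass : ∀ k, mass k = ((((((N : ℝ≥0∞) + 1)⁻¹ • Measure.sum fun i : Fin (N + 1) =>
      (Φ.lawAt (localGibbsLaw σ a₀ u₀ θ₀ N Φ) s).map fun z => z i).restrict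
      ({x : T3 | (fun i => ⌊(m : ℝ) * Torus.repr x i⌋₊) = k} ×ˢ (univ : Set V3))).snd) univ).toReal)
    (htemp : ∀ k, temp k = (3 * mass k)⁻¹ * ∫ v, ‖v - vel k‖ ^ 2 ∂(((((N : ℝ≥0∞) + 1)⁻¹ •
      Measure.sum fun i : Fin (N + 1) => (Φ.lawAt (localGibbsLaw σ a₀ u₀ θ₀ N Φ) s).map fun z => z i).restrict
      ({x : T3 | (fun i => ⌊(m : ℝ) * Torus.repr x i⌋₊) = k} ×ˢ (univ : Set V3))).snd))
    (hRk : ∀ k ∈ Fintype.piFinset (fun _ : Fin 3 => Finset.range m),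
      rlo ≤ (m : ℝ) ^ 3 * mass k ∧ (m : ℝ) ^ 3 * mass k ≤ rhi ∧ θlo ≤ temp k ∧ temp k ≤ θhi ∧ ‖vel k‖ ≤ V)
    {S₀ δ₁ δ₂ δ₃ : ℝ}
    (hK1 : ∑ k ∈ Fintype.piFinset (fun _ : Fin 3 => Finset.range m), mass k * (3 / 2 * Real.log (temp k) -
      Real.log ((m : ℝ) ^ 3 * mass k) - hsExcessFreeEnergy ((m : ℝ) ^ 3 * mass k * σ ^ 3)) ≤ S₀ + δ₁)
    (hTI : |(∫ z, (∫ y, Real.log (localGibbsProfile a₀ u₀ θ₀ y) ∂(empiricalMeasure z)) ∂(localGibbsLaw σ a₀ u₀ θ₀ N Φ)) -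
      ((N : ℝ) + 1)⁻¹ * Real.log (canonicalPartition (Torus.geometry (Fin 3)) (hsDiameter σ N) (N + 1)
        (localGibbsProfile a₀ u₀ θ₀)) - (-S₀ - 3 / 2 - 3 / 2 * Real.log (2 * Real.pi))| ≤ δ₂)
    (hLDA : |((N : ℝ) + 1)⁻¹ * Real.log (posPartition (fun x =>
        dite ((fun i => ⌊(m : ℝ) * Torus.repr x i⌋₊) ∈ Fintype.piFinset fun _ : Fin 3 => Finset.range m)
          (fun _ => (m : ℝ) ^ 3 * mass (fun i => ⌊(m : ℝ) * Torus.repr x i⌋₊)) (fun _ => rlo) *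
        Real.exp (g (dite ((fun i => ⌊(m : ℝ) * Torus.repr x i⌋₊) ∈ Fintype.piFinset fun _ : Fin 3 => Finset.range m)
          (fun _ => (m : ℝ) ^ 3 * mass (fun i => ⌊(m : ℝ) * Torus.repr x i⌋₊)) (fun _ => rlo)))) (hsDiameter σ N) (N + 1)) -
      ∑ j : ↥(Fintype.piFinset fun _ : Fin 3 => Finset.range m),
        ((m : ℝ)⁻¹) ^ 3 * ((m : ℝ) ^ 3 * mass j * ψ ((m : ℝ) ^ 3 * mass j))| ≤ δ₃) :
    ∃ (ca cθ : (Fin 3 → ℕ) → ℝ) (cu : (Fin 3 → ℕ) → V3),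
      (∀ k, A⁻¹ ≤ ca k ∧ ca k ≤ A ∧ Θ⁻¹ ≤ cθ k ∧ cθ k ≤ Θ ∧ ‖cu k‖ ≤ V) ∧
      klDiv (Φ.lawAt (localGibbsLaw σ a₀ u₀ θ₀ N Φ) s)
        (localGibbsLaw σ (fun x => ca (fun i => ⌊(m : ℝ) * Torus.repr x i⌋₊))
          (fun x => cu (fun i => ⌊(m : ℝ) * Torus.repr x i⌋₊))
          (fun x => cθ (fun i => ⌊(m : ℝ) * Torus.repr x i⌋₊)) N Φ) ≤
        ENNReal.ofReal ((δ₁ + δ₂ + δ₃) * ((N : ℝ) + 1)) := by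
  classical
  set K := Fintype.piFinset (fun _ : Fin 3 => Finset.range m) with hK
  -- the block-matched parameters
  set r : (Fin 3 → ℕ) → ℝ := fun k => dite (k ∈ K) (fun _ => (m : ℝ) ^ 3 * mass k) (fun _ => rlo) with hr
  set ca : (Fin 3 → ℕ) → ℝ := fun k => r k * Real.exp (g (r k)) with hca
  set cθ : (Fin 3 → ℕ) → ℝ := fun k => if k ∈ K then temp k else 1 with hcθ
  set cu : (Fin 3 → ℕ) → V3 := fun k => if k ∈ K then vel k else 0 with hcu
  have hrK : ∀ k ∈ K, r k = (m : ℝ) ^ 3 * mass k := fun k hk => by simp only [hr, dif_pos hk]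
  have hrI : ∀ k, r k ∈ Icc rlo rhi := by
    intro k
    by_cases hk : k ∈ K
    · rw [hrK k hk]; exact ⟨(hRk k hk).1, (hRk k hk).2.1⟩
    · simp only [hr, dif_neg hk]; exact ⟨le_rfl, hlohi⟩
  have hApos : 0 < A := by linarith
  have hΘpos : 0 < Θ := by linarith
  -- the parameter bounds
  have hbounds : ∀ k, A⁻¹ ≤ ca k ∧ ca k ≤ A ∧ Θ⁻¹ ≤ cθ k ∧ cθ k ≤ Θ ∧ ‖cu k‖ ≤ V := by
    intro k
    have hrk := hrI k
    have hgk := abs_le.1 (hgB _ hrk)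
    refine ⟨?_, ?_, ?_, ?_, ?_⟩
    · calc A⁻¹ ≤ rlo * Real.exp (-gB) := hAlo
        _ ≤ r k * Real.exp (g (r k)) :=
          mul_le_mul hrk.1 (Real.exp_le_exp.2 hgk.1) (Real.exp_pos _).le (hrlo.le.trans hrk.1)
    · calc r k * Real.exp (g (r k)) ≤ rhi * Real.exp gB :=
          mul_le_mul hrk.2 (Real.exp_le_exp.2 hgk.2) (Real.exp_pos _).le (hrlo.le.trans hlohi)
        _ ≤ A := hAhi
    · by_cases hk : k ∈ K
      · simp only [hcθ, if_pos hk]; exact hΘlo.trans (hRk k hk).2.2.1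
      · simp only [hcθ, if_neg hk]; exact inv_le_one_of_one_le₀ hΘ1
    · by_cases hk : k ∈ K
      · simp only [hcθ, if_pos hk]; exact (hRk k hk).2.2.2.1.trans hΘhi
      · simp only [hcθ, if_neg hk]; exact hΘ1
    · by_cases hk : k ∈ K
      · simp only [hcu, if_pos hk]; exact (hRk k hk).2.2.2.2
      · simp only [hcu, if_neg hk, norm_zero]; exact hV
  refine ⟨ca, cθ, cu, hbounds, ?_⟩
  -- the identity of part VI
  obtain ⟨hid, hne⟩ := toReal_klDiv_lawAt_blockRef hσ2 N Φ ha hθ hu ha0 hθ0 hm s hA1 hΘ1 hbounds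
  rw [← hK] at hid
  -- abbreviations for the block velocity measures
  set μ : Measure (T3 × V3) := ((N : ℝ≥0∞) + 1)⁻¹ • Measure.sum fun i : Fin (N + 1) =>
    (Φ.lawAt (localGibbsLaw σ a₀ u₀ θ₀ N Φ) s).map fun z => z i with hμ
  simp only [← hmass] at hid
  -- positivity of masses and the temperature identity on `K`
  have hm3 : (0 : ℝ) < (m : ℝ) ^ 3 := by positivity
  have hmassK : ∀ k ∈ K, 0 < mass k := fun k hk =>
    pos_of_mul_pos_right (hrlo.trans_le (hRk k hk).1) hm3.le
  have htempK : ∀ k ∈ K, ∫ v, ‖v - vel k‖ ^ 2 ∂((μ.restrict ({x : T3 | (fun i => ⌊(m : ℝ) * Torus.repr x i⌋₊) = k} ×ˢ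
      (univ : Set V3))).snd) = 3 * mass k * temp k := by
    intro k hk
    have h := htemp k
    have hm0 : mass k ≠ 0 := (hmassK k hk).ne'
    rw [h]
    field_simp
  have hsum1 : ∑ k ∈ K, mass k = 1 := by
    haveI : IsProbabilityMeasure (localGibbsLaw σ a₀ u₀ θ₀ N Φ) := isProbabilityMeasure_localGibbsLaw ha hθ hu ha0 hθ0 hσ2 N Φ
    haveI : IsProbabilityMeasure (Φ.lawAt (localGibbsLaw σ a₀ u₀ θ₀ N Φ) s) := by
      rw [HardSphereFlow.lawAt_eq]; exact Measure.isProbabilityMeasure_map (Φ.measurable_flow s).aemeasurable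
    have h := sum_blockMass_eq_one (Φ.lawAt (localGibbsLaw σ a₀ u₀ θ₀ N Φ) s) hm
    rw [← h]
    exact Finset.sum_congr rfl fun k _ => hmass k
  -- the log-partition function of the reference is the configurational one of `hLDA`
  have hidx := measurable_blockIdx m
  have hcam : Measurable fun x : T3 => ca (fun i => ⌊(m : ℝ) * Torus.repr x i⌋₊) := (measurable_of_countable ca).comp hidx
  have hcθm : Measurable fun x : T3 => cθ (fun i => ⌊(m : ℝ) * Torus.repr x i⌋₊) := (measurable_of_countable cθ).comp hidx
  have hcum : Measurable fun x : T3 => cu (fun i => ⌊(m : ℝ) * Torus.repr x i⌋₊) := (measurable_of_countable cu).comp hidx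
  have hca0 : ∀ k, 0 < ca k := fun k => (inv_pos.2 hApos).trans_le (hbounds k).1
  have hcθ0 : ∀ k, 0 < cθ k := fun k => (inv_pos.2 hΘpos).trans_le (hbounds k).2.2.1
  have hZb : canonicalPartition (Torus.geometry (Fin 3)) (hsDiameter σ N) (N + 1)
      (localGibbsProfile (fun x => ca (fun i => ⌊(m : ℝ) * Torus.repr x i⌋₊))
        (fun x => cu (fun i => ⌊(m : ℝ) * Torus.repr x i⌋₊)) (fun x => cθ (fun i => ⌊(m : ℝ) * Torus.repr x i⌋₊))) =
      posPartition (fun x => dite ((fun i => ⌊(m : ℝ) * Torus.repr x i⌋₊) ∈ K)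
          (fun _ => (m : ℝ) ^ 3 * mass (fun i => ⌊(m : ℝ) * Torus.repr x i⌋₊)) (fun _ => rlo) *
        Real.exp (g (dite ((fun i => ⌊(m : ℝ) * Torus.repr x i⌋₊) ∈ K)
          (fun _ => (m : ℝ) ^ 3 * mass (fun i => ⌊(m : ℝ) * Torus.repr x i⌋₊)) (fun _ => rlo))))
        (hsDiameter σ N) (N + 1) :=
    canonicalPartition_eq_posPartition_of_pos hcam hcθm hcum (fun x => hca0 _) (fun x => hcθ0 _) _ _
  -- the dimension constant
  have hfin : (Module.finrank ℝ V3 : ℝ) = 3 := by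
    rw [show Module.finrank ℝ V3 = 3 from finrank_euclideanSpace_fin]; norm_num
  -- the block terms on `K`
  have hterm : ∀ k ∈ K,
      mass k * (Real.log (ca k) + Real.log ((2 * Real.pi * cθ k) ^ (-(Module.finrank ℝ V3 : ℝ) / 2))) -
        (2 * cθ k)⁻¹ * ∫ v, ‖v - cu k‖ ^ 2 ∂((μ.restrict ({x : T3 | (fun i => ⌊(m : ℝ) * Torus.repr x i⌋₊) = k} ×ˢ
          (univ : Set V3))).snd) =
      -(mass k * (3 / 2 * Real.log (temp k) - Real.log ((m : ℝ) ^ 3 * mass k) -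
          hsExcessFreeEnergy ((m : ℝ) ^ 3 * mass k * σ ^ 3))) + mass k * ψ ((m : ℝ) ^ 3 * mass k) -
        (3 / 2 * Real.log (2 * Real.pi) + 3 / 2) * mass k := by
    intro k hk
    have hcuk : cu k = vel k := by simp only [hcu, if_pos hk]
    have hcθk : cθ k = temp k := by simp only [hcθ, if_pos hk]
    have htk : 0 < temp k := hθlo.trans_le (hRk k hk).2.2.1
    have hmk := hmassK k hk
    rw [hcuk, hcθk, htempK k hk]
    have hlogca : Real.log (ca k) = Real.log ((m : ℝ) ^ 3 * mass k) +
        hsExcessFreeEnergy ((m : ℝ) ^ 3 * mass k * σ ^ 3) + ψ ((m : ℝ) ^ 3 * mass k) := by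
      simp only [hca]
      rw [Real.log_mul (hrlo.trans_le (hrI k).1).ne' (Real.exp_pos _).ne', Real.log_exp, hrK k hk, hg]
      ring
    have hlogR : Real.log ((2 * Real.pi * temp k) ^ (-(Module.finrank ℝ V3 : ℝ) / 2)) =
        -(3 / 2) * (Real.log (2 * Real.pi) + Real.log (temp k)) := by
      rw [Real.log_rpow (mul_pos (mul_pos two_pos Real.pi_pos) htk), hfin,
        Real.log_mul (mul_pos two_pos Real.pi_pos).ne' htk.ne']
      ring
    rw [hlogca, hlogR]
    field_simp
    ring
  have hblock : ∑ k ∈ K, (mass k * (Real.log (ca k) + Real.log ((2 * Real.pi * cθ k) ^ (-(Module.finrank ℝ V3 : ℝ) / 2))) -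
        (2 * cθ k)⁻¹ * ∫ v, ‖v - cu k‖ ^ 2 ∂((μ.restrict ({x : T3 | (fun i => ⌊(m : ℝ) * Torus.repr x i⌋₊) = k} ×ˢ
          (univ : Set V3))).snd)) =
      -(∑ k ∈ K, mass k * (3 / 2 * Real.log (temp k) - Real.log ((m : ℝ) ^ 3 * mass k) -
          hsExcessFreeEnergy ((m : ℝ) ^ 3 * mass k * σ ^ 3))) + (∑ k ∈ K, mass k * ψ ((m : ℝ) ^ 3 * mass k)) -
        (3 / 2 * Real.log (2 * Real.pi) + 3 / 2) := by
    rw [Finset.sum_congr rfl hterm, Finset.sum_sub_distrib, Finset.sum_add_distrib, Finset.sum_neg_distrib,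
      ← Finset.mul_sum, hsum1, mul_one]
  -- the local density approximation in `Σ_{k ∈ K}` form
  have hΨ : ∑ j : ↥K, ((m : ℝ)⁻¹) ^ 3 * ((m : ℝ) ^ 3 * mass j * ψ ((m : ℝ) ^ 3 * mass j)) =
      ∑ k ∈ K, mass k * ψ ((m : ℝ) ^ 3 * mass k) := by
    rw [← Finset.sum_coe_sort K]
    refine Finset.sum_congr rfl fun j _ => ?_
    have hm0 : (m : ℝ) ≠ 0 := by exact_mod_cast hm.ne'
    field_simp
  rw [hΨ] at hLDA
  -- the real inequality
  have hreal : (klDiv (Φ.lawAt (localGibbsLaw σ a₀ u₀ θ₀ N Φ) s)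
      (localGibbsLaw σ (fun x => ca (fun i => ⌊(m : ℝ) * Torus.repr x i⌋₊))
        (fun x => cu (fun i => ⌊(m : ℝ) * Torus.repr x i⌋₊))
        (fun x => cθ (fun i => ⌊(m : ℝ) * Torus.repr x i⌋₊)) N Φ)).toReal ≤ (δ₁ + δ₂ + δ₃) * ((N : ℝ) + 1) := by
    rw [hid, hblock, hZb]
    have hN : (0 : ℝ) < (N : ℝ) + 1 := by positivity
    have h2 := abs_le.1 hTI
    have h3 := abs_le.1 hLDA
    -- abbreviate
    set TI := ∫ z, (∫ y, Real.log (localGibbsProfile a₀ u₀ θ₀ y) ∂(empiricalMeasure z)) ∂(localGibbsLaw σ a₀ u₀ θ₀ N Φ)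
    set LZ0 := Real.log (canonicalPartition (Torus.geometry (Fin 3)) (hsDiameter σ N) (N + 1) (localGibbsProfile a₀ u₀ θ₀))
    set LZ := Real.log (posPartition (fun x => dite ((fun i => ⌊(m : ℝ) * Torus.repr x i⌋₊) ∈ K)
          (fun _ => (m : ℝ) ^ 3 * mass (fun i => ⌊(m : ℝ) * Torus.repr x i⌋₊)) (fun _ => rlo) *
        Real.exp (g (dite ((fun i => ⌊(m : ℝ) * Torus.repr x i⌋₊) ∈ K)
          (fun _ => (m : ℝ) ^ 3 * mass (fun i => ⌊(m : ℝ) * Torus.repr x i⌋₊)) (fun _ => rlo))))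
        (hsDiameter σ N) (N + 1))
    set KS := ∑ k ∈ K, mass k * (3 / 2 * Real.log (temp k) - Real.log ((m : ℝ) ^ 3 * mass k) -
          hsExcessFreeEnergy ((m : ℝ) ^ 3 * mass k * σ ^ 3))
    set PS := ∑ k ∈ K, mass k * ψ ((m : ℝ) ^ 3 * mass k)
    -- `(N+1)⁻¹ log Z = LZ/(N+1)` bookkeeping: multiply the two approximations by `N+1`
    have e2 : (N + 1 : ℝ) * (TI - ((N : ℝ) + 1)⁻¹ * LZ0) = (N + 1 : ℝ) * TI - LZ0 := by field_simp
    have e3 : (N + 1 : ℝ) * (((N : ℝ) + 1)⁻¹ * LZ - PS) = LZ - (N + 1 : ℝ) * PS := by field_simp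
    have i2 : (N + 1 : ℝ) * (TI - ((N : ℝ) + 1)⁻¹ * LZ0) ≤ (N + 1 : ℝ) * (-S₀ - 3 / 2 - 3 / 2 * Real.log (2 * Real.pi) + δ₂) :=
      mul_le_mul_of_nonneg_left (by linarith [h2.2]) hN.le
    have i3 : (N + 1 : ℝ) * (((N : ℝ) + 1)⁻¹ * LZ - PS) ≤ (N + 1 : ℝ) * δ₃ :=
      mul_le_mul_of_nonneg_left (by linarith [h3.2]) hN.le
    have i1 : (N + 1 : ℝ) * KS ≤ (N + 1 : ℝ) * (S₀ + δ₁) := mul_le_mul_of_nonneg_left hK1 hN.le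
    rw [e2] at i2
    rw [e3] at i3
    nlinarith [i1, i2, i3]
  calc klDiv _ _ = ENNReal.ofReal (klDiv (Φ.lawAt (localGibbsLaw σ a₀ u₀ θ₀ N Φ) s)
        (localGibbsLaw σ (fun x => ca (fun i => ⌊(m : ℝ) * Torus.repr x i⌋₊))
          (fun x => cu (fun i => ⌊(m : ℝ) * Torus.repr x i⌋₊))
          (fun x => cθ (fun i => ⌊(m : ℝ) * Torus.repr x i⌋₊)) N Φ)).toReal := (ENNReal.ofReal_toReal hne).symm
    _ ≤ ENNReal.ofReal ((δ₁ + δ₂ + δ₃) * ((N : ℝ) + 1)) := ENNReal.ofReal_le_ofReal hreal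

end Summit.AtomisticToContinuum.HydrodynamicLimit.Theorems.JaynesSqueezeSqueeze

end
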